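/-
Copyright (c) 2026. All rights reserved.
Released under Apache 2.0 license as described in the file LICENSE.
-/
import Mathlib
import HarnessLib

/-!
# Finite sets from ncard positivity

If Set.ncard S > 0, then S is finite (ncard = 0 for infinite sets).
-/

open Set

noncomputable section

/-- A bound on ncard implies finiteness when the bound is positive.
From |ncard S - n| ≤ ε and n - ε > 0, we get ncard S > 0 hence S is finite. -/
theorem Set.finite_of_ncard_bound {α : Type*} {S : Set α} {n ε : ℝ}
    (hn : n - ε > 0) (hbound : |(S.ncard : ℝ) - n| ≤ ε) : S.Finite := by
  have h1 : (S.ncard : ℝ) ≥ n - ε := by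
    have := abs_le.mp hbound
    linarith [this.1]
  have h2 : (S.ncard : ℝ) > 0 := by linarith
  have h3 : S.ncard > 0 := by
    by_contra hle
    push Not at hle
    have : S.ncard = 0 := Nat.eq_zero_of_le_zero hle
    simp only [this, Nat.cast_zero] at h2
    exact lt_irrefl 0 h2
  exact Set.finite_of_ncard_pos h3

end
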